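import Summits.BirchSwinnertonDyer.Rank1Residual.X5.SelmerSolitaireQuadraticPolar
import Summits.BirchSwinnertonDyer.Rank1Residual.X5.SelmerSolitaireQuadraticInducedCube
import HarnessLib

/-!
# X5 · Selmer solitaire, quadratic layer — Q7 (part 1): the one-vertex FLIP LEMMA for the
# coordinate Lagrangians `Λ_n^{w}` (toward QS3, the parity / type law)

HONEST FRAMING (cell `b2b-bsdres`, run/shared/lean/b2b/bsd-rank1-residual/, verbatim in every
file): the goal of the cell is to DELETE the COMBINATION-SHAPED residual classes of the
Birch–Swinnerton-Dyer formula for ALL analytic-rank `≤ 1` elliptic curves over `ℚ` — "full BSD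
formula for every rank `≤ 1` curve in class `C`" assembled STRICTLY from published theorems — so
that the rank-`≤ 1` remainder becomes exactly the CONSTRUCTION-SHAPED classes, which are TYPED
(missing-input `Prop`s), NOT attempted. This is not "finishing BSD". O1 team (class X5, `p = 2`,
non-CM), ORDER v2.9 pool slot (ii‴) = lens-2 GEN 10's QUADRATIC-SPACE LAYER (o1 lead R-G20.3 /
R-G20.4, PLAN C150), item **Q7** (optional, QS3); pool hand = seat `b2b-bsdres-x11b3-p3` GEN 8 (x11b3
prover released to the o1 pool; yields to x11b3 deals). PURE `𝔽₂` LINEAR ALGEBRA about the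
vocabulary of `X5/SelmerSolitaireQuadratic.lean` (x11b3-p4, p283641; spelling of record = lens-2's
seat sketch `HOME/b2b-bsdres-o1-idea-2-g10/lean/O1Stub1QuadraticSketch.lean`): THEOREMS ONLY (no
definition, no named fact, no `sorry`); nothing arithmetic is asserted (the dictionary AR1–AR4 to
Selmer groups is NOT here); reach-neutral (R1 closes no class; QS3 is "a law, not load-bearing",
lens-2 2G10.2); nothing booked; O1 OPEN.

## What is proved (`U` a totally singular Lagrangian of `Q_D`, `ℓ ∉ n ⊆ D`)

Write `Λ_n^{w} := {x ∈ Λ_n : x_∞ ∈ ⟨w⟩}` (`(x_∞).2 = 0`): a COORDINATE Lagrangian of `Q_D` — one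
singular line chosen at every vertex, the Kummer line `w` at `∞`. No definition is introduced: the
two subspaces enter the statements as arbitrary submodules `Λ₁`, `Λ₂` with membership hypotheses
`x ∈ Λ₁ ↔ (x none).2 = 0 ∧ InLam n x`, `x ∈ Λ₂ ↔ (x none).2 = 0 ∧ InLam (insert ℓ n) x`.

* §1 test vectors (`Pi.single` at `∞` / `t_i` / `u_i` lie in `Λ_n`) and `𝔽₂²` bookkeeping.
* §2 `Parity.exists_relaxed_apply_ne_zero` (NONDEGENERACY STEP): some `x ∈ U` satisfying the
  common conditions of `Λ₁`, `Λ₂` off `ℓ` has `x_ℓ ≠ 0`. Proof by duality in the nondegenerate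
  symmetric (alternating) polar form `B` of `q` (x11b3-p4's `X5/SelmerSolitaireQuadraticPolar`:
  bilinearity, `mem_of_forall_polar_eq_zero` = "`U = U^⊥`"): with `A = Λ₁ ∩ Λ₂`, if every relaxed
  vector of `U` vanished at `ℓ` then `(U + A)^⊥ ⊆ A` (test vectors in `A`), hence
  `A^⊥ ⊆ (U + A)^{⊥⊥} = U + A` (Mathlib `LinearMap.BilinForm.orthogonal_orthogonal`), but
  `u_ℓ ∈ A^⊥` then reads `u_ℓ = x + a` with `x ∈ U` relaxed and `x_ℓ = u_ℓ ≠ 0`.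
  `Parity.finrank_eq_succ_of_forall_mem_or_sub_mem` (rank bookkeeping `X = Y ⊕ ⟨x₀⟩`) and the
  **FLIP LEMMA `Parity.flip`**: `dim (U ∩ Λ₂) = dim (U ∩ Λ₁) ± 1` — the reduction of `U` to the
  hyperbolic plane `H_ℓ` is exactly ONE of its two singular lines `⟨u_ℓ⟩`, `⟨t_ℓ⟩` (`q(x₀) = 0`
  makes `x₀,ℓ` singular; two relaxed vectors of `U` with `ℓ`-values `u_ℓ`, `t_ℓ` would add up to an
  anisotropic one), so one of `U ∩ Λ₁`, `U ∩ Λ₂` is `U ∩ Λ₁ ∩ Λ₂` and the other is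
  `(U ∩ Λ₁ ∩ Λ₂) ⊕ ⟨x₀⟩`; `Parity.finrank_flip_zmod2` is the statement modulo `2`.

Part 2 (`X5/SelmerSolitaireQuadraticParity.lean`) derives the invariance of
`dim (U ∩ Λ_n^{w}) + |n| (mod 2)` and QS3 `parityLaw_holds`. Mathematically this is the `𝔽₂`-shadow
of the TWO FAMILIES of maximal totally singular subspaces of the split quadratic space `Q_D`
(two Lagrangians lie in the same family iff their intersection has dimension `≡ dim/2 (mod 2)`).

References: lens-2 GEN 5 (G5.3 T1) and GEN 10 (2G10.2 QS3, 2G10.6 Q7), `cells/o1/ROUTES-O1.md`;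
B. Poonen, E. Rains, JAMS 25 (2012) §2–§4 (quadratic spaces over `𝔽₂`, maximal isotropic subspaces)
[cite: PoonenRains2012, §2]; B. Mazur, K. Rubin, *Introduction to Kolyvagin systems*, Contemp.
Math. 358 (2004), Def. 4.2 [cite: MazurRubin2004Intro, Def. 4.2]. Folklore linear algebra (the two
families of maximal totally singular subspaces of a split quadratic space over `𝔽₂`).

## Tree search (dedup, 2026-08-21)
`lean search 'Quadratic.Parity|parityLaw|orthogonal_orthogonal'` in `Summits/` → none for the
stems; Q4a (`polar_*`, `polar_single_fst/snd`, `mem_of_forall_polar_eq_zero`), Q5 (`Cube.*`) and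
p2's `NF.*` consumed BY NAME; INBOX grep 'QuadraticParity' → 2G10.6 and this hand's INTENT (l.5307).
-/

namespace Summit.BirchSwinnertonDyer.Rank1Residual.X5.SelmerSolitaire.Quadratic

open Finset SelmerSolitaire

variable {s : ℕ}

namespace Parity

/-! ### §1 Test vectors and the relaxed conditions -/

/-- `Pi.single ∞ a ∈ Λ_n` for every `a` (no condition at finite vertices is violated). [folklore] -/
theorem inLam_single_none (n : Finset (Fin s)) (a : ZMod 2 × ZMod 2) :
    InLam n (Pi.single (none : V s) a) := fun i ↦
  ⟨fun _ ↦ by rw [Pi.single_eq_of_ne (Option.some_ne_none i)]; rfl,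
   fun _ ↦ by rw [Pi.single_eq_of_ne (Option.some_ne_none i)]; rfl⟩

/-- The transverse test vector `t_i ∈ Λ_n` for `i ∈ n`. [folklore] -/
theorem inLam_single_snd {n : Finset (Fin s)} {i : Fin s} (hi : i ∈ n) (c : ZMod 2) :
    InLam n (Pi.single (some i : V s) ((0, c) : ZMod 2 × ZMod 2)) := fun j ↦ by
  by_cases hj : j = i
  · subst hj
    exact ⟨fun _ ↦ by rw [Pi.single_eq_same], fun h ↦ absurd hi h⟩
  · have hne : (some j : V s) ≠ some i := fun h ↦ hj (Option.some_injective _ h)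
    exact ⟨fun _ ↦ by rw [Pi.single_eq_of_ne hne]; rfl, fun _ ↦ by rw [Pi.single_eq_of_ne hne]; rfl⟩

/-- The unramified test vector `u_i ∈ Λ_n` for `i ∉ n`. [folklore] -/
theorem inLam_single_fst {n : Finset (Fin s)} {i : Fin s} (hi : i ∉ n) (c : ZMod 2) :
    InLam n (Pi.single (some i : V s) ((c, 0) : ZMod 2 × ZMod 2)) := fun j ↦ by
  by_cases hj : j = i
  · subst hj
    exact ⟨fun h ↦ absurd h hi, fun _ ↦ by rw [Pi.single_eq_same]⟩
  · have hne : (some j : V s) ≠ some i := fun h ↦ hj (Option.some_injective _ h)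
    exact ⟨fun _ ↦ by rw [Pi.single_eq_of_ne hne]; rfl, fun _ ↦ by rw [Pi.single_eq_of_ne hne]; rfl⟩

/-- A vector of `𝔽₂²` which is non-zero and singular has coordinate sum `1` (it is `w` or `w′`).
[folklore] -/
theorem fst_add_snd_eq_one : ∀ a : ZMod 2 × ZMod 2, a ≠ 0 → a.1 * a.2 = 0 → a.1 + a.2 = 1 := by
  decide

/-- A singular non-zero vector of `𝔽₂²` is `(1,0)` or `(0,1)`. [folklore] -/
theorem eq_or_eq_of_singular : ∀ a : ZMod 2 × ZMod 2, a.1 * a.2 = 0 → a = 0 ∨ a = (1, 0) ∨ a = (0, 1) := by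
  decide

/-! ### §2 The one-vertex FLIP LEMMA -/

/-- **Nondegeneracy step of the flip lemma.** Let `U` be a totally singular Lagrangian, `ℓ ∉ n`,
and `Λ₁ = Λ_n^{w}`, `Λ₂ = Λ_{n ∪ ℓ}^{w}` the two coordinate Lagrangians (`∞`-part on the Kummer line
`w`). Then some `x ∈ U` satisfying their COMMON conditions off `ℓ` has `x_ℓ ≠ 0`. Proof: otherwise,
with `A = Λ₁ ∩ Λ₂`, every vector orthogonal to `U + A` lies in `U` (`U = U^⊥`) and satisfies the
relaxed conditions (test vectors in `A`), hence lies in `A`; dualising (`A^{⊥⊥} = A`,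
Mathlib `LinearMap.BilinForm.orthogonal_orthogonal`) `A^⊥ ⊆ U + A`; but `u_ℓ ∈ A^⊥`, so
`u_ℓ = x + a` with `x ∈ U` relaxed and `x_ℓ = u_ℓ ≠ 0`. [folklore] -/
theorem exists_relaxed_apply_ne_zero {U : Submodule (ZMod 2) (QVec s)} (hU : IsTSLagrangian U)
    {n : Finset (Fin s)} {l : Fin s} (hl : l ∉ n) (Λ₁ Λ₂ : Submodule (ZMod 2) (QVec s))
    (h₁ : ∀ x, x ∈ Λ₁ ↔ (x none).2 = 0 ∧ InLam n x)
    (h₂ : ∀ x, x ∈ Λ₂ ↔ (x none).2 = 0 ∧ InLam (insert l n) x) :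
    ∃ x ∈ U, (x none).2 = 0 ∧
      (∀ i : Fin s, i ≠ l → (i ∈ n → (x (some i)).1 = 0) ∧ (i ∉ n → (x (some i)).2 = 0)) ∧
      x (some l) ≠ 0 := by
  classical
  by_contra hcon
  push Not at hcon
  -- the polar form as a nondegenerate reflexive bilinear form
  let B : LinearMap.BilinForm (ZMod 2) (QVec s) :=
    LinearMap.mk₂ (ZMod 2) polar polar_add_left polar_smul_left polar_add_right polar_smul_right
  have hBapply : ∀ x y, B x y = polar x y := fun _ _ ↦ rfl
  have hB : B.Nondegenerate :=
    ⟨fun x hx ↦ eq_zero_of_forall_polar_eq_zero fun y ↦ by rw [← hBapply]; exact hx y,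
     fun y hy ↦ eq_zero_of_forall_polar_eq_zero fun x ↦ by rw [polar_comm, ← hBapply]; exact hy x⟩
  have hBr : B.IsRefl := fun x y h ↦ by rw [hBapply] at h ⊢; rwa [polar_comm]
  set A : Submodule (ZMod 2) (QVec s) := Λ₁ ⊓ Λ₂ with hA
  have hmemA : ∀ a, a ∈ A ↔ a ∈ Λ₁ ∧ a ∈ Λ₂ := fun a ↦ Submodule.mem_inf
  -- elements of `A` vanish at `ℓ`
  have hAl : ∀ a ∈ A, a (some l) = 0 := fun a ha ↦ by
    obtain ⟨ha1, ha2⟩ := (hmemA a).mp ha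
    exact Prod.ext (((h₂ a).mp ha2).2 l |>.1 (mem_insert_self l n))
      (((h₁ a).mp ha1).2 l |>.2 hl)
  -- (††) `(U + A)^⊥ ≤ A`
  have hOA : B.orthogonal (U ⊔ A) ≤ A := by
    intro y hy
    rw [LinearMap.BilinForm.mem_orthogonal_iff] at hy
    have hy' : ∀ z ∈ U ⊔ A, polar z y = 0 := fun z hz ↦ by rw [← hBapply]; exact hy z hz
    -- `y ∈ U`
    have hyU : y ∈ U := mem_of_forall_polar_eq_zero hU fun u hu ↦ by
      rw [polar_comm]; exact hy' u (Submodule.mem_sup_left hu)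
    -- `y` satisfies the relaxed conditions (test vectors in `A`)
    have hyinf : (y none).2 = 0 := by
      have hmem : (Pi.single (none : V s) ((1, 0) : ZMod 2 × ZMod 2)) ∈ A :=
        (hmemA _).mpr ⟨(h₁ _).mpr ⟨by rw [Pi.single_eq_same], inLam_single_none n _⟩,
          (h₂ _).mpr ⟨by rw [Pi.single_eq_same], inLam_single_none _ _⟩⟩
      have := hy' _ (Submodule.mem_sup_right hmem)
      rwa [polar_comm, polar_single_fst] at this
    have hyrel : ∀ i : Fin s, i ≠ l →
        (i ∈ n → (y (some i)).1 = 0) ∧ (i ∉ n → (y (some i)).2 = 0) := by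
      intro i hi
      refine ⟨fun hin ↦ ?_, fun hin ↦ ?_⟩
      · have hmem : (Pi.single (some i : V s) ((0, 1) : ZMod 2 × ZMod 2)) ∈ A :=
          (hmemA _).mpr ⟨(h₁ _).mpr ⟨by rw [Pi.single_eq_of_ne (Option.some_ne_none i).symm]; rfl,
              inLam_single_snd hin 1⟩,
            (h₂ _).mpr ⟨by rw [Pi.single_eq_of_ne (Option.some_ne_none i).symm]; rfl,
              inLam_single_snd (mem_insert_of_mem hin) 1⟩⟩
        have := hy' _ (Submodule.mem_sup_right hmem)
        rwa [polar_comm, polar_single_snd] at this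
      · have hin' : i ∉ insert l n := fun h ↦ ((mem_insert.mp h).elim hi hin)
        have hmem : (Pi.single (some i : V s) ((1, 0) : ZMod 2 × ZMod 2)) ∈ A :=
          (hmemA _).mpr ⟨(h₁ _).mpr ⟨by rw [Pi.single_eq_of_ne (Option.some_ne_none i).symm]; rfl,
              inLam_single_fst hin 1⟩,
            (h₂ _).mpr ⟨by rw [Pi.single_eq_of_ne (Option.some_ne_none i).symm]; rfl,
              inLam_single_fst hin' 1⟩⟩
        have := hy' _ (Submodule.mem_sup_right hmem)
        rwa [polar_comm, polar_single_fst] at this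
    -- hence `y_ℓ = 0` by the standing assumption, and `y ∈ A`
    have hyl : y (some l) = 0 := hcon y hyU hyinf hyrel
    refine (hmemA y).mpr ⟨(h₁ y).mpr ⟨hyinf, fun i ↦ ?_⟩, (h₂ y).mpr ⟨hyinf, fun i ↦ ?_⟩⟩
    · by_cases hi : i = l
      · subst hi; exact ⟨fun h ↦ absurd h hl, fun _ ↦ by rw [hyl]; rfl⟩
      · exact hyrel i hi
    · by_cases hi : i = l
      · subst hi; exact ⟨fun _ ↦ by rw [hyl]; rfl, fun h ↦ absurd (mem_insert_self i n) h⟩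
      · refine ⟨fun h ↦ (hyrel i hi).1 ((mem_insert.mp h).resolve_left hi),
          fun h ↦ (hyrel i hi).2 fun h' ↦ h (mem_insert_of_mem h')⟩
  -- dualising: `A^⊥ ≤ U + A`
  have hle : B.orthogonal A ≤ U ⊔ A :=
    (LinearMap.BilinForm.orthogonal_le hOA).trans
      (LinearMap.BilinForm.orthogonal_orthogonal hB hBr (U ⊔ A)).le
  -- `u_ℓ ∈ A^⊥`
  have hu : (Pi.single (some l : V s) ((1, 0) : ZMod 2 × ZMod 2)) ∈ B.orthogonal A := by
    rw [LinearMap.BilinForm.mem_orthogonal_iff]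
    intro a ha
    rw [hBapply, polar_single_fst, hAl a ha]
    rfl
  obtain ⟨x, hxU, a, haA, hxa⟩ := Submodule.mem_sup.mp (hle hu)
  obtain ⟨ha1, -⟩ := (hmemA a).mp haA
  obtain ⟨hainf, han⟩ := (h₁ a).mp ha1
  -- `x = u_ℓ - a` is relaxed with `x_ℓ = u_ℓ ≠ 0`
  have hx : x = Pi.single (some l : V s) ((1, 0) : ZMod 2 × ZMod 2) - a := eq_sub_of_add_eq hxa
  have hxinf : (x none).2 = 0 := by
    rw [hx, Pi.sub_apply, Prod.snd_sub, hainf, Pi.single_eq_of_ne (Option.some_ne_none l).symm]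
    simp
  have hxrel : ∀ i : Fin s, i ≠ l →
      (i ∈ n → (x (some i)).1 = 0) ∧ (i ∉ n → (x (some i)).2 = 0) := by
    intro i hi
    have hne : (some i : V s) ≠ some l := fun h ↦ hi (Option.some_injective _ h)
    refine ⟨fun hin ↦ ?_, fun hin ↦ ?_⟩
    · rw [hx, Pi.sub_apply, Prod.fst_sub, (han i).1 hin, Pi.single_eq_of_ne hne]; simp
    · rw [hx, Pi.sub_apply, Prod.snd_sub, (han i).2 hin, Pi.single_eq_of_ne hne]; simp
  have hxl : x (some l) = 0 := hcon x hxU hxinf hxrel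
  rw [hx, Pi.sub_apply, hAl a haA, sub_zero, Pi.single_eq_same] at hxl
  exact one_ne_zero (congrArg Prod.fst hxl)

/-- Rank bookkeeping: if `Y ≤ X`, `x₀ ∈ X ∖ Y`, and every element of `X` lies in `Y` or differs from
`x₀` by an element of `Y`, then `dim X = dim Y + 1` (`X = Y ⊕ ⟨x₀⟩`). [folklore] -/
theorem finrank_eq_succ_of_forall_mem_or_sub_mem {X Y : Submodule (ZMod 2) (QVec s)} (hYX : Y ≤ X)
    {x₀ : QVec s} (hx₀X : x₀ ∈ X) (hx₀Y : x₀ ∉ Y) (hX : ∀ y ∈ X, y ∈ Y ∨ y - x₀ ∈ Y) :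
    Module.finrank (ZMod 2) X = Module.finrank (ZMod 2) Y + 1 := by
  have hx₀0 : x₀ ≠ 0 := fun h ↦ hx₀Y (h ▸ Y.zero_mem)
  have hsup : X = Y ⊔ (ZMod 2 ∙ x₀) := by
    apply le_antisymm
    · intro y hy
      rcases hX y hy with h | h
      · exact Submodule.mem_sup_left h
      · have : y = (y - x₀) + x₀ := (sub_add_cancel y x₀).symm
        rw [this]
        exact Submodule.add_mem _ (Submodule.mem_sup_left h)
          (Submodule.mem_sup_right (Submodule.mem_span_singleton_self x₀))
    · exact sup_le hYX ((Submodule.span_singleton_le_iff_mem x₀ X).mpr hx₀X)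
  have hdisj : Y ⊓ (ZMod 2 ∙ x₀) = ⊥ :=
    disjoint_iff.mp ((Submodule.disjoint_span_singleton' hx₀0).mpr hx₀Y)
  have h := Submodule.finrank_sup_add_finrank_inf_eq Y (ZMod 2 ∙ x₀)
  rw [hdisj, finrank_bot, add_zero, finrank_span_singleton hx₀0, ← hsup] at h
  exact h

/-- **FLIP LEMMA.** For a totally singular Lagrangian `U`, `ℓ ∉ n`, and the coordinate Lagrangians
`Λ₁ = Λ_n^{w}`, `Λ₂ = Λ_{n ∪ ℓ}^{w}`: `dim (U ∩ Λ₂) = dim (U ∩ Λ₁) ± 1`. (The reduction of `U` to the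
hyperbolic plane `H_ℓ` is exactly one of its two singular lines `⟨u_ℓ⟩`, `⟨t_ℓ⟩`: a relaxed `x₀ ∈ U`
with `x₀,ℓ ≠ 0` exists by `exists_relaxed_apply_ne_zero`, `q(x₀) = 0` makes `x₀,ℓ` singular, and two
relaxed vectors with `ℓ`-values `u_ℓ`, `t_ℓ` would sum to an anisotropic one; so one of `U ∩ Λ₁`,
`U ∩ Λ₂` is `U ∩ Λ₁ ∩ Λ₂` and the other is `(U ∩ Λ₁ ∩ Λ₂) ⊕ ⟨x₀⟩`.) [folklore] -/
theorem flip {U : Submodule (ZMod 2) (QVec s)} (hU : IsTSLagrangian U)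
    {n : Finset (Fin s)} {l : Fin s} (hl : l ∉ n) (Λ₁ Λ₂ : Submodule (ZMod 2) (QVec s))
    (h₁ : ∀ x, x ∈ Λ₁ ↔ (x none).2 = 0 ∧ InLam n x)
    (h₂ : ∀ x, x ∈ Λ₂ ↔ (x none).2 = 0 ∧ InLam (insert l n) x) :
    Module.finrank (ZMod 2) ↥(U ⊓ Λ₁) = Module.finrank (ZMod 2) ↥(U ⊓ Λ₂) + 1 ∨
      Module.finrank (ZMod 2) ↥(U ⊓ Λ₂) = Module.finrank (ZMod 2) ↥(U ⊓ Λ₁) + 1 := by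
  obtain ⟨x₀, hx₀U, hx₀inf, hx₀rel, hx₀l⟩ := exists_relaxed_apply_ne_zero hU hl Λ₁ Λ₂ h₁ h₂
  -- `q` on relaxed vectors
  have hqrel : ∀ x : QVec s, (x none).2 = 0 →
      (∀ i : Fin s, i ≠ l → (i ∈ n → (x (some i)).1 = 0) ∧ (i ∉ n → (x (some i)).2 = 0)) →
      qform x = (x (some l)).1 * (x (some l)).2 := fun x hxinf hxrel ↦ by
    rw [Cube.qform_eq_of_relaxed hxrel, hxinf, mul_zero, zero_add]
  have hx₀sing : (x₀ (some l)).1 * (x₀ (some l)).2 = 0 := by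
    rw [← hqrel x₀ hx₀inf hx₀rel]; exact hU.1 x₀ hx₀U
  -- relaxed conditions for members of `Λ₁`, `Λ₂`
  have hrel₁ : ∀ y ∈ Λ₁, (y none).2 = 0 ∧
      ∀ i : Fin s, i ≠ l → (i ∈ n → (y (some i)).1 = 0) ∧ (i ∉ n → (y (some i)).2 = 0) :=
    fun y hy ↦ ⟨((h₁ y).mp hy).1, fun i _ ↦ ((h₁ y).mp hy).2 i⟩
  have hrel₂ : ∀ y ∈ Λ₂, (y none).2 = 0 ∧
      ∀ i : Fin s, i ≠ l → (i ∈ n → (y (some i)).1 = 0) ∧ (i ∉ n → (y (some i)).2 = 0) :=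
    fun y hy ↦ ⟨((h₂ y).mp hy).1, fun i hi ↦
      ⟨fun hin ↦ ((h₂ y).mp hy).2 i |>.1 (mem_insert_of_mem hin),
       fun hin ↦ ((h₂ y).mp hy).2 i |>.2 fun h ↦ (mem_insert.mp h).elim hi hin⟩⟩
  -- the anisotropy obstruction: no `y ∈ U`, relaxed, has `ℓ`-value `x₀,ℓ + (1,1)`-type complement
  have hanis : ∀ y ∈ U, (y none).2 = 0 →
      (∀ i : Fin s, i ≠ l → (i ∈ n → (y (some i)).1 = 0) ∧ (i ∉ n → (y (some i)).2 = 0)) →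
      x₀ (some l) + y (some l) ≠ (1, 1) := by
    intro y hyU hyinf hyrel hsum
    have hq := hU.1 (x₀ + y) (U.add_mem hx₀U hyU)
    have hrel : ∀ i : Fin s, i ≠ l →
        (i ∈ n → ((x₀ + y) (some i)).1 = 0) ∧ (i ∉ n → ((x₀ + y) (some i)).2 = 0) := fun i hi ↦
      ⟨fun hin ↦ by rw [Pi.add_apply, Prod.fst_add, (hx₀rel i hi).1 hin, (hyrel i hi).1 hin, add_zero],
       fun hin ↦ by rw [Pi.add_apply, Prod.snd_add, (hx₀rel i hi).2 hin, (hyrel i hi).2 hin, add_zero]⟩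
    have hinf : ((x₀ + y) none).2 = 0 := by rw [Pi.add_apply, Prod.snd_add, hx₀inf, hyinf, add_zero]
    rw [hqrel _ hinf hrel, Pi.add_apply, hsum, mul_one] at hq
    exact one_ne_zero hq
  -- membership transfer along the `ℓ`-coordinate
  have hmem₁ : ∀ y : QVec s, (y none).2 = 0 →
      (∀ i : Fin s, i ≠ l → (i ∈ n → (y (some i)).1 = 0) ∧ (i ∉ n → (y (some i)).2 = 0)) →
      (y (some l)).2 = 0 → y ∈ Λ₁ := fun y hyinf hyrel hyl ↦
    (h₁ y).mpr ⟨hyinf, Cube.inLam_of_relaxed hl hyrel hyl⟩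
  have hmem₂ : ∀ y : QVec s, (y none).2 = 0 →
      (∀ i : Fin s, i ≠ l → (i ∈ n → (y (some i)).1 = 0) ∧ (i ∉ n → (y (some i)).2 = 0)) →
      (y (some l)).1 = 0 → y ∈ Λ₂ := fun y hyinf hyrel hyl ↦
    (h₂ y).mpr ⟨hyinf, Cube.inLam_insert_of_relaxed hyrel hyl⟩
  rcases eq_or_eq_of_singular _ hx₀sing with h0 | he | hf
  · exact absurd h0 hx₀l
  · -- `x₀,ℓ = u_ℓ`: `U ∩ Λ₂ ≤ U ∩ Λ₁ = (U ∩ Λ₂… ) ⊕ ⟨x₀⟩`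
    left
    have hx₀Λ₁ : x₀ ∈ Λ₁ := hmem₁ x₀ hx₀inf hx₀rel (by rw [he])
    refine finrank_eq_succ_of_forall_mem_or_sub_mem (X := U ⊓ Λ₁) (Y := U ⊓ Λ₂) ?_ ⟨hx₀U, hx₀Λ₁⟩
      (fun h ↦ ?_) fun y hy ↦ ?_
    · -- `U ∩ Λ₂ ≤ U ∩ Λ₁`
      rintro y ⟨hyU, hyΛ₂⟩
      obtain ⟨hyinf, hyrel⟩ := hrel₂ y hyΛ₂
      have hyl1 : (y (some l)).1 = 0 := ((h₂ y).mp hyΛ₂).2 l |>.1 (mem_insert_self l n)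
      have hyl2 : (y (some l)).2 = 0 := by
        have h01 : ∀ a : ZMod 2, a = 0 ∨ a = 1 := by decide
        rcases h01 (y (some l)).2 with h | h
        · exact h
        · exact absurd (Prod.ext (by rw [Prod.fst_add, he, hyl1]; rfl) (by rw [Prod.snd_add, he, h]; rfl))
            (hanis y hyU hyinf hyrel)
      exact ⟨hyU, hmem₁ y hyinf hyrel hyl2⟩
    · exact one_ne_zero ((congrArg Prod.fst he).symm.trans (((h₂ x₀).mp h.2).2 l |>.1 (mem_insert_self l n)))
    · obtain ⟨hyU, hyΛ₁⟩ := hy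
      obtain ⟨hyinf, hyrel⟩ := hrel₁ y hyΛ₁
      have hyl2 : (y (some l)).2 = 0 := ((h₁ y).mp hyΛ₁).2 l |>.2 hl
      have h01 : ∀ a : ZMod 2, a = 0 ∨ a = 1 := by decide
      rcases h01 (y (some l)).1 with h | h
      · exact Or.inl ⟨hyU, hmem₂ y hyinf hyrel h⟩
      · right
        refine ⟨U.sub_mem hyU hx₀U, hmem₂ _ ?_ ?_ ?_⟩
        · rw [Pi.sub_apply, Prod.snd_sub, hyinf, hx₀inf, sub_zero]
        · intro i hi
          exact ⟨fun hin ↦ by rw [Pi.sub_apply, Prod.fst_sub, (hyrel i hi).1 hin, (hx₀rel i hi).1 hin, sub_zero],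
            fun hin ↦ by rw [Pi.sub_apply, Prod.snd_sub, (hyrel i hi).2 hin, (hx₀rel i hi).2 hin, sub_zero]⟩
        · rw [Pi.sub_apply, Prod.fst_sub, h, he, sub_self]
  · -- `x₀,ℓ = t_ℓ`: symmetric
    right
    have hx₀Λ₂ : x₀ ∈ Λ₂ := hmem₂ x₀ hx₀inf hx₀rel (by rw [hf])
    refine finrank_eq_succ_of_forall_mem_or_sub_mem (X := U ⊓ Λ₂) (Y := U ⊓ Λ₁) ?_ ⟨hx₀U, hx₀Λ₂⟩
      (fun h ↦ ?_) fun y hy ↦ ?_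
    · rintro y ⟨hyU, hyΛ₁⟩
      obtain ⟨hyinf, hyrel⟩ := hrel₁ y hyΛ₁
      have hyl2 : (y (some l)).2 = 0 := ((h₁ y).mp hyΛ₁).2 l |>.2 hl
      have hyl1 : (y (some l)).1 = 0 := by
        have h01 : ∀ a : ZMod 2, a = 0 ∨ a = 1 := by decide
        rcases h01 (y (some l)).1 with h | h
        · exact h
        · exact absurd (Prod.ext (by rw [Prod.fst_add, hf, h]; rfl) (by rw [Prod.snd_add, hf, hyl2]; rfl))
            (hanis y hyU hyinf hyrel)
      exact ⟨hyU, hmem₂ y hyinf hyrel hyl1⟩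
    · exact one_ne_zero ((congrArg Prod.snd hf).symm.trans (((h₁ x₀).mp h.2).2 l |>.2 hl))
    · obtain ⟨hyU, hyΛ₂⟩ := hy
      obtain ⟨hyinf, hyrel⟩ := hrel₂ y hyΛ₂
      have hyl1 : (y (some l)).1 = 0 := ((h₂ y).mp hyΛ₂).2 l |>.1 (mem_insert_self l n)
      have h01 : ∀ a : ZMod 2, a = 0 ∨ a = 1 := by decide
      rcases h01 (y (some l)).2 with h | h
      · exact Or.inl ⟨hyU, hmem₁ y hyinf hyrel h⟩
      · right
        refine ⟨U.sub_mem hyU hx₀U, hmem₁ _ ?_ ?_ ?_⟩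
        · rw [Pi.sub_apply, Prod.snd_sub, hyinf, hx₀inf, sub_zero]
        · intro i hi
          exact ⟨fun hin ↦ by rw [Pi.sub_apply, Prod.fst_sub, (hyrel i hi).1 hin, (hx₀rel i hi).1 hin, sub_zero],
            fun hin ↦ by rw [Pi.sub_apply, Prod.snd_sub, (hyrel i hi).2 hin, (hx₀rel i hi).2 hin, sub_zero]⟩
        · rw [Pi.sub_apply, Prod.snd_sub, h, hf, sub_self]

/-- The flip lemma modulo `2`: `dim (U ∩ Λ_{n ∪ ℓ}^{w}) ≡ dim (U ∩ Λ_n^{w}) + 1`. [folklore] -/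
theorem finrank_flip_zmod2 {U : Submodule (ZMod 2) (QVec s)} (hU : IsTSLagrangian U)
    {n : Finset (Fin s)} {l : Fin s} (hl : l ∉ n) (Λ₁ Λ₂ : Submodule (ZMod 2) (QVec s))
    (h₁ : ∀ x, x ∈ Λ₁ ↔ (x none).2 = 0 ∧ InLam n x)
    (h₂ : ∀ x, x ∈ Λ₂ ↔ (x none).2 = 0 ∧ InLam (insert l n) x) :
    (Module.finrank (ZMod 2) ↥(U ⊓ Λ₂) : ZMod 2) = Module.finrank (ZMod 2) ↥(U ⊓ Λ₁) + 1 := by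
  have h2 : (2 : ZMod 2) = 0 := by decide
  rcases flip hU hl Λ₁ Λ₂ h₁ h₂ with h | h
  · rw [h, Nat.cast_add, Nat.cast_one]
    linear_combination -h2
  · rw [h, Nat.cast_add, Nat.cast_one]

end Parity

end Summit.BirchSwinnertonDyer.Rank1Residual.X5.SelmerSolitaire.Quadratic
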